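import Mathlib.Algebra.Polynomial.Derivative
import Mathlib.Algebra.Polynomial.Eval.Defs
import Mathlib.Algebra.Field.Basic
import Mathlib.Tactic.LinearCombination
import Mathlib.Tactic.FieldSimp
import HarnessLib

/-!
# The CM chart identities in MODEL coordinates: from the certificate shapes `P(℘ z) = ℘(αz)·Q(℘ z)`,
# `α℘′(αz)·Q(℘ z)² = (P′Q − PQ′)(℘ z)·℘′(z)` to the `x`/`y`-shape identities, and their transport along ring maps
# (de Shalit II.1.10 / II.4.9 (ii) bookkeeping — proofs only)

Topic `NumberTheory/EllipticCurves` (theorems only; no definition, no named fact, no instance; pure field algebra).  Cell `bsd-print-cf2`,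
width seat `bsd-line-cf2c-w4` g15, brick B7 of the memo `ALPHA-ASSEMBLY-w4g15.md`: the point identity
`some_add_ptOfZ_evalPt₁_eq_of_cm_identities` (`CMFormalActionNilIdealPointsChart`) consumes, for the target point `Z = (x_Z, y_Z)` and
`P₁ ⊕ P(t) = (X₀, Y₀)`, the two identities
(X) `(x_Z + φb)·Q.eval₂ φ (X₀ + φb) = P.eval₂ φ (X₀ + φb)` and
(Y) `φα·(2y_Z + φa₁·x_Z + φa₃)·Q.eval₂ φ (X₀ + φb) + (x_Z + φb)·(Q′).eval₂ φ (X₀ + φb)·(2Y₀ + φa₁X₀ + φa₃) = (P′).eval₂ φ (X₀ + φb)·(2Y₀ + φa₁X₀ + φa₃)`.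
Over `ℂ`, with `X₀ + b = ℘(z)`, `2Y₀ + a₁X₀ + a₃ = ℘′(z)` (model coordinates of `ξ(z)`: `x = ℘ − b₂/12`, `y = (℘′ − a₁x − a₃)/2`) and the same
for `Z = ξ(αz)`, these ARE the certificate identities of `LatticeTransformationIdentity` (`eval_weierstrassP_eq_weierstrassP_mul_mul`,
`derivWeierstrassP_mul_of_transformation`) once `Q(℘ z) ≠ 0` is cancelled.  This file is that algebra, stated over any field, plus the
transport of the two shapes along ring maps (forward) and injective ring maps (backward) — the assembler's path `ℂ ← K̄ → K̄_v ← M_m`: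

* ★ `cmChart_of_certificate` — from `P.eval₂ φ p = q·Q.eval₂ φ p`, `φα·d′·(Q.eval₂ φ p)² = (P′Q − PQ′).eval₂ φ p·d`, `Q.eval₂ φ p ≠ 0` and the
  model dictionary `X₀ + φb = p`, `2Y₀ + φa₁X₀ + φa₃ = d`, `x_Z + φb = q`, `2y_Z + φa₁x_Z + φa₃ = d′`: (X) ∧ (Y);
* `cmChart_map` — (X) ∧ (Y) for `(φ; X₀, Y₀, x_Z, y_Z)` ⇒ (X) ∧ (Y) for `(θ ∘ φ; θX₀, θY₀, θx_Z, θy_Z)`;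
* `cmChart_of_map_injective` — the converse for `θ` injective.

No summit statement is proved; BSD is not proved by any of this.

## References
* [deShalit1987] E. de Shalit, *Iwasawa theory of elliptic curves with complex multiplication* (1987), II §1.10, II §4.9 (ii).
* [SilvermanATAEC1994] J. H. Silverman, *Advanced Topics in the Arithmetic of Elliptic Curves* (1994), II Prop. 1.1.
* [Cox2013] D. A. Cox, *Primes of the form x² + ny²*, 2nd ed. (2013), Prop. 14.9.
-/

noncomputable section

namespace Literature.NumberTheory.EllipticCurves

open Polynomial

section Algebra

variable {A : Type*} [CommRing A] {F : Type*} [Field F] (φ : A →+* F)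

/-- ★ **The chart identities from the certificate identities.**  In a field `F`, reading `A`-polynomials `P, Q` and scalars `α, b, a₁, a₃`
through `φ : A → F`: if `P(p) = q·Q(p)` (the transformation identity `P(℘ z) = ℘(αz)Q(℘ z)`), `φα·d′·Q(p)² = (P′Q − PQ′)(p)·d`
(its derivative form, `α℘′(αz)Q(℘z)² = (P′Q − PQ′)(℘ z)℘′(z)`), `Q(p) ≠ 0`, and `(X₀, Y₀)`, `(x_Z, y_Z)` are the MODEL coordinates of the
two points (`X₀ + φb = p`, `2Y₀ + φa₁X₀ + φa₃ = d`, `x_Z + φb = q`, `2y_Z + φa₁x_Z + φa₃ = d′`), then the `x`-shape identity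
`(x_Z + φb)·Q(X₀ + φb) = P(X₀ + φb)` and the `y`-shape identity of `CMFormalActionNilIdealPointsChart` hold.
[cite: deShalit1987, II §4.9 (ii)] [cite: Cox2013, Prop. 14.9] -/
theorem cmChart_of_certificate {P Q : A[X]} {α b a₁ a₃ : A} {p q d d' X₀ Y₀ xZ yZ : F}
    (hP : P.eval₂ φ p = q * Q.eval₂ φ p)
    (hD : φ α * d' * Q.eval₂ φ p ^ 2 = (derivative P * Q - P * derivative Q).eval₂ φ p * d)
    (hQ : Q.eval₂ φ p ≠ 0)
    (hX₀ : X₀ + φ b = p) (hY₀ : 2 * Y₀ + φ a₁ * X₀ + φ a₃ = d) (hxZ : xZ + φ b = q) (hyZ : 2 * yZ + φ a₁ * xZ + φ a₃ = d') :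
    (xZ + φ b) * Q.eval₂ φ (X₀ + φ b) = P.eval₂ φ (X₀ + φ b) ∧
      φ α * (2 * yZ + φ a₁ * xZ + φ a₃) * Q.eval₂ φ (X₀ + φ b) +
          (xZ + φ b) * (derivative Q).eval₂ φ (X₀ + φ b) * (2 * Y₀ + φ a₁ * X₀ + φ a₃) =
        (derivative P).eval₂ φ (X₀ + φ b) * (2 * Y₀ + φ a₁ * X₀ + φ a₃) := by
  rw [hX₀, hY₀, hxZ, hyZ]
  refine ⟨by rw [hP], ?_⟩
  rw [eval₂_sub, eval₂_mul, eval₂_mul] at hD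
  -- `φα·d′·Q(p)² = (P′(p)Q(p) − P(p)Q′(p))·d` with `P(p) = q Q(p)`: cancel one `Q(p)`
  have h : (φ α * d' * Q.eval₂ φ p + q * (derivative Q).eval₂ φ p * d - (derivative P).eval₂ φ p * d) * Q.eval₂ φ p = 0 := by
    linear_combination hD - d * (derivative Q).eval₂ φ p * hP
  rcases mul_eq_zero.mp h with h' | h'
  · exact sub_eq_zero.mp h'
  · exact absurd h' hQ

end Algebra

section Transport

variable {A : Type*} [CommRing A] {F F' : Type*} [Field F] [Field F'] (φ : A →+* F) (θ : F →+* F')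

/-- **The chart identities map forward along a ring map** `θ : F → F'` (polynomials read through `θ ∘ φ`). [cite: deShalit1987, II §4.9 (ii)] -/
theorem cmChart_map {P Q : A[X]} {α b a₁ a₃ : A} {X₀ Y₀ xZ yZ : F}
    (hX : (xZ + φ b) * Q.eval₂ φ (X₀ + φ b) = P.eval₂ φ (X₀ + φ b))
    (hY : φ α * (2 * yZ + φ a₁ * xZ + φ a₃) * Q.eval₂ φ (X₀ + φ b) +
          (xZ + φ b) * (derivative Q).eval₂ φ (X₀ + φ b) * (2 * Y₀ + φ a₁ * X₀ + φ a₃) =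
        (derivative P).eval₂ φ (X₀ + φ b) * (2 * Y₀ + φ a₁ * X₀ + φ a₃)) :
    (θ xZ + (θ.comp φ) b) * Q.eval₂ (θ.comp φ) (θ X₀ + (θ.comp φ) b) = P.eval₂ (θ.comp φ) (θ X₀ + (θ.comp φ) b) ∧
      (θ.comp φ) α * (2 * θ yZ + (θ.comp φ) a₁ * θ xZ + (θ.comp φ) a₃) * Q.eval₂ (θ.comp φ) (θ X₀ + (θ.comp φ) b) +
          (θ xZ + (θ.comp φ) b) * (derivative Q).eval₂ (θ.comp φ) (θ X₀ + (θ.comp φ) b) *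
            (2 * θ Y₀ + (θ.comp φ) a₁ * θ X₀ + (θ.comp φ) a₃) =
        (derivative P).eval₂ (θ.comp φ) (θ X₀ + (θ.comp φ) b) * (2 * θ Y₀ + (θ.comp φ) a₁ * θ X₀ + (θ.comp φ) a₃) := by
  have e : θ X₀ + (θ.comp φ) b = θ (X₀ + φ b) := by rw [map_add, RingHom.comp_apply]
  have hev : ∀ R : A[X], R.eval₂ (θ.comp φ) (θ (X₀ + φ b)) = θ (R.eval₂ φ (X₀ + φ b)) := fun R => (hom_eval₂ R φ θ _).symm
  simp only [e, hev]
  have h1 := congrArg θ hX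
  have h2 := congrArg θ hY
  simp only [map_mul, map_add, map_ofNat] at h1 h2
  refine ⟨?_, ?_⟩
  · simpa only [RingHom.comp_apply] using h1
  · simpa only [RingHom.comp_apply] using h2

/-- **… and are reflected along an injective ring map** (`ℂ ← K̄`, `K̄_v ← M_m`). [cite: deShalit1987, II §4.9 (ii)] -/
theorem cmChart_of_map_injective (hθ : Function.Injective θ) {P Q : A[X]} {α b a₁ a₃ : A} {X₀ Y₀ xZ yZ : F}
    (hX : (θ xZ + (θ.comp φ) b) * Q.eval₂ (θ.comp φ) (θ X₀ + (θ.comp φ) b) = P.eval₂ (θ.comp φ) (θ X₀ + (θ.comp φ) b))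
    (hY : (θ.comp φ) α * (2 * θ yZ + (θ.comp φ) a₁ * θ xZ + (θ.comp φ) a₃) * Q.eval₂ (θ.comp φ) (θ X₀ + (θ.comp φ) b) +
          (θ xZ + (θ.comp φ) b) * (derivative Q).eval₂ (θ.comp φ) (θ X₀ + (θ.comp φ) b) *
            (2 * θ Y₀ + (θ.comp φ) a₁ * θ X₀ + (θ.comp φ) a₃) =
        (derivative P).eval₂ (θ.comp φ) (θ X₀ + (θ.comp φ) b) * (2 * θ Y₀ + (θ.comp φ) a₁ * θ X₀ + (θ.comp φ) a₃)) :
    (xZ + φ b) * Q.eval₂ φ (X₀ + φ b) = P.eval₂ φ (X₀ + φ b) ∧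
      φ α * (2 * yZ + φ a₁ * xZ + φ a₃) * Q.eval₂ φ (X₀ + φ b) +
          (xZ + φ b) * (derivative Q).eval₂ φ (X₀ + φ b) * (2 * Y₀ + φ a₁ * X₀ + φ a₃) =
        (derivative P).eval₂ φ (X₀ + φ b) * (2 * Y₀ + φ a₁ * X₀ + φ a₃) := by
  have e : θ X₀ + (θ.comp φ) b = θ (X₀ + φ b) := by rw [map_add, RingHom.comp_apply]
  have hev : ∀ R : A[X], R.eval₂ (θ.comp φ) (θ (X₀ + φ b)) = θ (R.eval₂ φ (X₀ + φ b)) := fun R => (hom_eval₂ R φ θ _).symm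
  simp only [e, hev] at hX hY
  refine ⟨hθ ?_, hθ ?_⟩
  · simpa only [map_mul, map_add, RingHom.comp_apply] using hX
  · simpa only [map_mul, map_add, map_ofNat, RingHom.comp_apply] using hY

end Transport

end Literature.NumberTheory.EllipticCurves

end
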